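import Summits.Parity.GeneralizedHardyLittlewood.Theorems.LiouvilleShiftedTablesBVLiouville
import Literature.NumberTheory.Sieve.BombieriVinogradovMoebius
import Literature.NumberTheory.Sieve.RoughNumbersCoprimeProgressions
import HarnessLib

/-!
# Route `LeeYangFibres`, crux `AbsoluteUpgrade` (stmt-Parity-14116), line `nlc-cells-absolute-clip`:
# helper file 2 for the stub `stub_singlesDecay` — Liouville sums along a linear form in a residue
# class, and Bombieri–Vinogradov for `λ` over value intervals

* `sum_filter_Icc_modEq_eq` — **values of a progression, class by class**: for `a > 0`, `d > 0`,
  `a m₁ + b > 0`, the values `a m + b`, `m ∈ [m₁, m₂]`, `m ≡ s (mod d)`, are exactly the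
  `v ∈ (a(m₁ − 1) + b, a m₂ + b]` with `v ≡ a s + b (mod a d)`; so a sum over `m` of a function of the
  value is a sum over a residue class in a segment of `ℕ` (the tree's
  `DimOne.card_filter_Icc_eq_card_filter_Ioc` is the case of counts, `d = 1`).
* `sum_filter_Icc_modEq_neg` — the reflection `m ↦ −m` reducing `a < 0` to `a > 0`.
* `filter_Ioc_modEq_eq` — the class `c (mod q)` in `(0, V]` is `{c} ∪ {qn + c : 1 ≤ n ≤ (V − c)/q}`.
* `bv_intervals` — **Bombieri–Vinogradov for `λ` over intervals, all residues**: for `ε, A > 0`,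
  `∑_{q ≤ x^{1/2−ε}} |∑_{V₁(q) < v ≤ V₂(q), v ≡ r(q) (mod q)} λ(v)| ≤ C x/(log x)^A` for arbitrary
  residues `r(q) ∈ ℤ` and heights `V₁(q) ≤ V₂(q) ≤ x` — from the tree's PROVED route item
  `BVLiouville` (`Cruxes.TypeI2Dilated.PeelToDrappeau.BVLiouville_proof`: one residue and one height
  per modulus, inner sums `∑_{n ≤ y/q} λ(qn + c)`), applied twice (at the two ends of each interval).

References: É. Fouvry, G. Tenenbaum, *Multiplicative functions in large arithmetic progressions and
applications*, Trans. AMS 375 (2022), Thm. 1.8 [FouvryTenenbaum2021]; H. Iwaniec, E. Kowalski,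
*Analytic Number Theory* (2004), Thm. 17.4 [IwaniecKowalski2004].
-/

noncomputable section

open Finset ArithmeticFunction

namespace Summit.Parity.GeneralizedHardyLittlewood.Theorems.AbsoluteUpgrade

open Summit.Parity.GeneralizedHardyLittlewood.Cruxes.TypeI2Dilated.PeelToDrappeau (BVLiouville_proof)
open Literature.NumberTheory.Sieve.BVMoebius (eventually_log_rpow_le_rpow')

/-! ### Values of a progression, class by class -/

/-- **Values of a progression, class by class.** For `a > 0`, `d > 0` and `a m₁ + b > 0`, the values
`a m + b`, `m ∈ [m₁, m₂]`, `m ≡ s (mod d)`, are exactly the members of the class `a s + b (mod a d)` in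
the segment `(a(m₁ − 1) + b, a m₂ + b]` of `ℕ` (lower end truncated at `0` by `Int.toNat` if
negative), so a sum over `m` of a function of the value is a sum over that class in that segment.
[folklore] -/
theorem sum_filter_Icc_modEq_eq {a d : ℤ} (ha : 0 < a) (hd : 0 < d) {b m₁ : ℤ}
    (hpos : 0 < a * m₁ + b) (m₂ s : ℤ) (f : ℕ → ℝ) :
    ∑ m ∈ (Icc m₁ m₂).filter (fun m : ℤ => m ≡ s [ZMOD d]), f (a * m + b).toNat =
      ∑ v ∈ (Ioc (a * (m₁ - 1) + b).toNat (a * m₂ + b).toNat).filter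
        (fun v : ℕ => (v : ℤ) ≡ a * s + b [ZMOD a * d]), f v := by
  -- adapted from `Literature.NumberTheory.Sieve.DimOne.card_filter_Icc_eq_card_filter_Ioc`
  have had : 0 < a * d := mul_pos ha hd
  refine Finset.sum_nbij' (fun m => (a * m + b).toNat) (fun v => ((v : ℤ) - b) / a)
    (fun m hm => ?_) (fun v hv => ?_) (fun m hm => ?_) (fun v hv => ?_) (fun m _ => rfl)
  · -- `m ↦ a m + b` lands in the segment and the class
    rw [Finset.mem_filter, Finset.mem_Icc] at hm
    rw [Finset.mem_filter, Finset.mem_Ioc]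
    obtain ⟨⟨h1, h2⟩, hmod⟩ := hm
    have hv0 : 0 < a * m + b := by nlinarith
    refine ⟨⟨?_, ?_⟩, ?_⟩
    · exact (Int.toNat_lt_toNat hv0).mpr (by nlinarith)
    · exact Int.toNat_le_toNat (by nlinarith)
    · rw [Int.toNat_of_nonneg hv0.le, Int.modEq_iff_dvd]
      obtain ⟨k, hk⟩ := Int.modEq_iff_dvd.mp hmod
      exact ⟨k, by linear_combination a * hk⟩
  · -- a member `v` of the class in the segment comes from `m = (v - b)/a ∈ [m₁, m₂]`
    rw [Finset.mem_filter, Finset.mem_Ioc] at hv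
    rw [Finset.mem_filter, Finset.mem_Icc]
    obtain ⟨⟨h1, h2⟩, hmod⟩ := hv
    obtain ⟨k, hk⟩ := Int.modEq_iff_dvd.mp hmod
    -- `v = a (s - d k) + b`
    have hv : (v : ℤ) = a * (s - d * k) + b := by linear_combination (-1 : ℤ) * hk
    have hdiv : ((v : ℤ) - b) / a = s - d * k := by
      rw [hv, add_sub_cancel_right, Int.mul_ediv_cancel_left _ ha.ne']
    rw [hdiv]
    have hV2 : 0 < a * m₂ + b := by
      by_contra h
      push Not at h
      have : (a * m₂ + b).toNat = 0 := Int.toNat_eq_zero.mpr h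
      omega
    have hle : (v : ℤ) ≤ a * m₂ + b := by
      have : ((v : ℕ) : ℤ) ≤ ((a * m₂ + b).toNat : ℤ) := by exact_mod_cast h2
      rwa [Int.toNat_of_nonneg hV2.le] at this
    have hlt : a * (m₁ - 1) + b < v := by
      rcases le_or_gt (a * (m₁ - 1) + b) 0 with h0 | h0
      · have : (0 : ℤ) < v := by
          have : 0 < v := by omega
          exact_mod_cast this
        linarith
      · have : ((a * (m₁ - 1) + b).toNat : ℤ) < ((v : ℕ) : ℤ) := by exact_mod_cast h1
        rwa [Int.toNat_of_nonneg h0.le] at this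
    refine ⟨⟨?_, ?_⟩, ?_⟩
    · by_contra hcon
      push Not at hcon
      have : a * (s - d * k) ≤ a * (m₁ - 1) := by nlinarith
      linarith
    · by_contra hcon
      push Not at hcon
      have : a * m₂ < a * (s - d * k) := by nlinarith
      linarith
    · exact Int.modEq_iff_dvd.mpr ⟨k, by ring⟩
  · -- left inverse
    rw [Finset.mem_filter, Finset.mem_Icc] at hm
    have hv0 : 0 ≤ a * m + b := by nlinarith
    change (((a * m + b).toNat : ℤ) - b) / a = m
    rw [Int.toNat_of_nonneg hv0, add_sub_cancel_right, Int.mul_ediv_cancel_left _ ha.ne']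
  · -- right inverse
    rw [Finset.mem_filter, Finset.mem_Ioc] at hv
    obtain ⟨-, hmod⟩ := hv
    obtain ⟨k, hk⟩ := Int.modEq_iff_dvd.mp hmod
    have hv : (v : ℤ) = a * (s - d * k) + b := by linear_combination (-1 : ℤ) * hk
    change (a * (((v : ℤ) - b) / a) + b).toNat = v
    rw [hv, add_sub_cancel_right, Int.mul_ediv_cancel_left _ ha.ne', ← hv, Int.toNat_natCast]

/-- Reflection `m ↦ −m`: a sum over `{m ∈ [m₁, m₂] : m ≡ s (mod d)}` of a function of `a m + b` is the
same sum over `{m ∈ [−m₂, −m₁] : m ≡ −s (mod d)}` for `(−a) m + b`. [folklore] -/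
theorem sum_filter_Icc_modEq_neg (a b m₁ m₂ s d : ℤ) (g : ℤ → ℝ) :
    ∑ m ∈ (Icc m₁ m₂).filter (fun m : ℤ => m ≡ s [ZMOD d]), g (a * m + b) =
      ∑ m ∈ (Icc (-m₂) (-m₁)).filter (fun m : ℤ => m ≡ -s [ZMOD d]), g (-a * m + b) := by
  refine Finset.sum_nbij' (fun m => -m) (fun m => -m) (fun m hm => ?_) (fun m hm => ?_)
    (fun m _ => by ring) (fun m _ => by ring) (fun m _ => by ring_nf)
  · simp only [Finset.mem_filter, Finset.mem_Icc] at hm ⊢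
    exact ⟨⟨by omega, by omega⟩, hm.2.neg⟩
  · simp only [Finset.mem_filter, Finset.mem_Icc] at hm ⊢
    refine ⟨⟨by omega, by omega⟩, ?_⟩
    have := hm.2.neg
    rwa [neg_neg] at this

/-! ### The class `c (mod q)` in `(0, V]` -/

/-- For `c < q`: the members of the class `c (mod q)` in `(0, V]` are `c` itself (if `1 ≤ c ≤ V`)
and the `qn + c` with `1 ≤ n ≤ (V − c)/q`. [folklore] -/
theorem filter_Ioc_modEq_eq {q c : ℕ} (hc : c < q) (V : ℕ) :
    (Ioc 0 V).filter (fun v : ℕ => v % q = c) =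
      (if 1 ≤ c ∧ c ≤ V then {c} else ∅) ∪ (Icc 1 ((V - c) / q)).image (fun n => q * n + c) := by
  have hq : 0 < q := by omega
  ext v
  simp only [Finset.mem_filter, Finset.mem_Ioc, Finset.mem_union, Finset.mem_image,
    Finset.mem_Icc]
  constructor
  · rintro ⟨⟨hv1, hvV⟩, hmod⟩
    have hdm := Nat.div_add_mod v q
    rw [hmod] at hdm
    rcases Nat.eq_zero_or_pos (v / q) with h0 | hpos
    · left
      rw [h0, mul_zero, zero_add] at hdm
      subst hdm
      rw [if_pos ⟨hv1, hvV⟩]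
      exact Finset.mem_singleton_self _
    · right
      refine ⟨v / q, ⟨hpos, ?_⟩, hdm⟩
      exact (Nat.le_div_iff_mul_le hq).mpr (by rw [mul_comm]; omega)
  · rintro (h | ⟨n, ⟨hn1, hnN⟩, rfl⟩)
    · split_ifs at h with hcV
      · rw [Finset.mem_singleton] at h
        subst h
        exact ⟨⟨hcV.1, hcV.2⟩, Nat.mod_eq_of_lt hc⟩
      · exact absurd h (Finset.notMem_empty _)
    · have h1 : q * n ≤ V - c := by
        have := (Nat.le_div_iff_mul_le hq).mp hnN
        rwa [mul_comm] at this
      have hqn : q ≤ q * n := Nat.le_mul_of_pos_right q hn1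
      refine ⟨⟨by omega, by omega⟩, ?_⟩
      rw [Nat.mul_add_mod, Nat.mod_eq_of_lt hc]

/-- For `c < q`: `∑_{0 < v ≤ V, v ≡ c (mod q)} f(v) = [1 ≤ c ≤ V] f(c) + ∑_{1 ≤ n ≤ (V−c)/q} f(qn + c)`.
[folklore] -/
theorem sum_filter_Ioc_modEq_eq {q c : ℕ} (hc : c < q) (V : ℕ) (f : ℕ → ℝ) :
    ∑ v ∈ (Ioc 0 V).filter (fun v : ℕ => v % q = c), f v =
      (if 1 ≤ c ∧ c ≤ V then f c else 0) + ∑ n ∈ Icc 1 ((V - c) / q), f (q * n + c) := by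
  have hq : 0 < q := by omega
  have hdisj : Disjoint (if 1 ≤ c ∧ c ≤ V then ({c} : Finset ℕ) else ∅)
      ((Icc 1 ((V - c) / q)).image (fun n => q * n + c)) := by
    split_ifs with h
    · rw [Finset.disjoint_singleton_left, Finset.mem_image]
      rintro ⟨n, hn, hnc⟩
      rw [Finset.mem_Icc] at hn
      have : q ≤ q * n := Nat.le_mul_of_pos_right q hn.1
      omega
    · exact Finset.disjoint_empty_left _
  have hinj : Set.InjOn (fun n => q * n + c) ↑(Icc 1 ((V - c) / q)) := by
    intro n₁ _ n₂ _ h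
    exact Nat.eq_of_mul_eq_mul_left hq (by simpa using h)
  rw [filter_Ioc_modEq_eq hc V, Finset.sum_union hdisj, Finset.sum_image hinj]
  congr 1
  split_ifs <;> simp

/-- For `c < q`: `|∑_{0 < v ≤ V, v ≡ c (mod q)} λ(v)| ≤ |∑_{1 ≤ n ≤ (V−c)/q} λ(qn + c)| + 1`. [folklore] -/
theorem abs_sum_filter_Ioc_modEq_le {q c : ℕ} (hc : c < q) (V : ℕ) :
    |∑ v ∈ (Ioc 0 V).filter (fun v : ℕ => v % q = c), (liouville v : ℝ)| ≤
      |∑ n ∈ Icc 1 ((V - c) / q), (liouville (q * n + c) : ℝ)| + 1 := by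
  rw [sum_filter_Ioc_modEq_eq hc V]
  have h1 : |(if 1 ≤ c ∧ c ≤ V then (liouville c : ℝ) else 0)| ≤ 1 := by
    split_ifs
    · exact Literature.NumberTheory.LFunctions.LiouvilleSum.abs_liouville_le_one c
    · simp
  calc _ ≤ |(if 1 ≤ c ∧ c ≤ V then (liouville c : ℝ) else 0)| +
        |∑ n ∈ Icc 1 ((V - c) / q), (liouville (q * n + c) : ℝ)| := abs_add_le _ _
    _ ≤ _ := by linarith

/-- A sum over a class in `(V₁, V₂]` is the difference of the sums over the class in `(0, V₂]` and in
`(0, V₁]` (`V₁ ≤ V₂`). [folklore] -/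
theorem sum_filter_Ioc_eq_sub (p : ℕ → Prop) [DecidablePred p] (f : ℕ → ℝ) {V₁ V₂ : ℕ}
    (h : V₁ ≤ V₂) :
    ∑ v ∈ (Ioc V₁ V₂).filter p, f v =
      ∑ v ∈ (Ioc 0 V₂).filter p, f v - ∑ v ∈ (Ioc 0 V₁).filter p, f v := by
  rw [Finset.sum_filter, Finset.sum_filter, Finset.sum_filter,
    ← Finset.sum_Ioc_consecutive _ (Nat.zero_le V₁) h]
  ring

/-- A class `r (mod q)` (`q ≥ 1`, `r ∈ ℤ`) has at most `(V₂ − V₁)/q + 1` members in `(V₁, V₂]`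
(tree: `BFI.abs_card_Ioc_filter_modEq_sub_le`). [folklore] -/
theorem card_filter_Ioc_intModEq_le {q : ℕ} (hq : 0 < q) (r : ℤ) {V₁ V₂ : ℕ} (hV : V₁ ≤ V₂) :
    (#((Ioc V₁ V₂).filter (fun v : ℕ => (v : ℤ) ≡ r [ZMOD q])) : ℝ) ≤ ((V₂ : ℝ) - V₁) / q + 1 := by
  set c := (r % q).toNat with hc
  have hq' : (0 : ℤ) < q := by exact_mod_cast hq
  have hc0 : 0 ≤ r % q := Int.emod_nonneg _ hq'.ne'
  have hceq : ((c : ℕ) : ℤ) = r % q := Int.toNat_of_nonneg hc0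
  have hclt : c < q := by
    have h1 := Int.emod_lt_of_pos r hq'
    rw [← hceq] at h1
    exact_mod_cast h1
  have hfilt : (Ioc V₁ V₂).filter (fun v : ℕ => (v : ℤ) ≡ r [ZMOD q]) =
      (Ioc V₁ V₂).filter (fun v : ℕ => v ≡ c [MOD q]) := by
    refine Finset.filter_congr fun v _ => ?_
    rw [Nat.ModEq, Nat.mod_eq_of_lt hclt]
    have e : ((v : ℤ) ≡ r [ZMOD (q : ℤ)]) ↔ ((v % q : ℕ) : ℤ) = ((c : ℕ) : ℤ) := by
      rw [hceq, Int.natCast_mod]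
      rfl
    rw [e]
    exact Int.natCast_inj
  rw [hfilt]
  have h := Literature.NumberTheory.Sieve.BFI.abs_card_Ioc_filter_modEq_sub_le hq c hV
  linarith [(abs_le.mp h).2]

/-! ### Bombieri–Vinogradov for `λ` over intervals, all residues -/

/-- **Bombieri–Vinogradov for the Liouville function over intervals, arbitrary residues.** For
`ε, A > 0` there are `C, x₀` such that for `x ≥ x₀`, any residues `r(q) ∈ ℤ` and any integer heights
`V₁(q) ≤ V₂(q) ≤ x`,
`∑_{q ≤ x^{1/2−ε}} |∑_{V₁(q) < v ≤ V₂(q), v ≡ r(q) (mod q)} λ(v)| ≤ C x/(log x)^A`.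
From the route item `BVLiouville` (PROVED in the tree, `BVLiouville_proof`: one residue
`0 ≤ c_q < q` and one height `y_q ≤ x` per modulus, inner sums `∑_{n ≤ y_q/q} λ(qn + c_q)`), applied at
the two ends of each interval: the class `c (mod q)` in `(0, V]` is the progression `qn + c`,
`1 ≤ n ≤ (V − c)/q`, plus possibly the single point `c` (`abs_sum_filter_Ioc_modEq_le`).
[cite: IwaniecKowalski2004, Theorem 17.4] -/
theorem bv_intervals : ∀ (ε : ℝ), 0 < ε → ∀ (A : ℝ), 0 < A → ∃ C x₀ : ℝ, ∀ x : ℝ, x₀ ≤ x → ∀ r : ℕ → ℤ, ∀ V₁ V₂ : ℕ → ℕ, (∀ q, V₁ q ≤ V₂ q) → (∀ q, ((V₂ q : ℕ) : ℝ) ≤ x) → ∑ q ∈ Icc 1 ⌊x ^ (1 / 2 - ε)⌋₊, |∑ v ∈ (Ioc (V₁ q) (V₂ q)).filter (fun v : ℕ => (v : ℤ) ≡ r q [ZMOD q]), (liouville v : ℝ)| ≤ C * x / Real.log x ^ A := by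
  intro ε hε A hA
  obtain ⟨C₀, x₀, hBV⟩ := BVLiouville_proof ε hε A hA
  obtain ⟨x₁, hx₁⟩ := Filter.eventually_atTop.1 ((Filter.eventually_ge_atTop x₀).and
    ((Filter.eventually_ge_atTop (2 : ℝ)).and
      (eventually_log_rpow_le_rpow' A (by positivity : (0 : ℝ) < 1 / 2 + ε))))
  refine ⟨2 * C₀ + 2, x₁, fun x hx r V₁ V₂ hV hVx => ?_⟩
  obtain ⟨hxx₀, hx2, hlog⟩ := hx₁ x hx
  have hx0 : 0 < x := by linarith
  set L := Real.log x with hL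
  have hL0 : 0 < L := Real.log_pos (by linarith)
  have hLA : 0 < L ^ A := Real.rpow_pos_of_pos hL0 A
  set Q := ⌊x ^ (1 / 2 - ε)⌋₊ with hQ
  -- per-modulus data: the residue `0 ≤ c_q < q` and the two heights
  set c : ℕ → ℤ := fun q => r q % q with hcdef
  set cn : ℕ → ℕ := fun q => (c q).toNat with hcn
  set N' : ℕ → ℕ → ℕ := fun q V => (V - cn q) / q with hN'
  set y₁ : ℕ → ℝ := fun q => ((q * N' q (V₁ q) : ℕ) : ℝ) with hy₁def
  set y₂ : ℕ → ℝ := fun q => ((q * N' q (V₂ q) : ℕ) : ℝ) with hy₂def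
  have hc : ∀ q, 1 ≤ q → 0 ≤ c q ∧ c q < q := fun q hq =>
    ⟨Int.emod_nonneg _ (by exact_mod_cast (by omega : q ≠ 0)),
      Int.emod_lt_of_pos _ (by exact_mod_cast hq)⟩
  have hcn_eq : ∀ q, 1 ≤ q → ((cn q : ℕ) : ℤ) = c q := fun q hq =>
    Int.toNat_of_nonneg (hc q hq).1
  have hcn_lt : ∀ q, 1 ≤ q → cn q < q := fun q hq => by
    have h1 := (hc q hq).2
    rw [← hcn_eq q hq] at h1
    exact_mod_cast h1
  -- the heights are admissible
  have hN'le : ∀ q V, q * N' q V ≤ V := fun q V =>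
    (Nat.mul_div_le (V - cn q) q).trans (Nat.sub_le _ _)
  have hy : ∀ (W : ℕ → ℕ), (∀ q, ((W q : ℕ) : ℝ) ≤ x) →
      ∀ q, 0 ≤ (((q * N' q (W q) : ℕ) : ℝ)) ∧ (((q * N' q (W q) : ℕ) : ℝ)) ≤ x := fun W hW q =>
    ⟨Nat.cast_nonneg _, le_trans (by exact_mod_cast hN'le q (W q)) (hW q)⟩
  have hV₁x : ∀ q, ((V₁ q : ℕ) : ℝ) ≤ x := fun q => le_trans (by exact_mod_cast hV q) (hVx q)
  have h1 := hBV x hxx₀ c y₁ hc (hy V₁ hV₁x)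
  have h2 := hBV x hxx₀ c y₂ hc (hy V₂ hVx)
  -- the Bombieri–Vinogradov terms are the progression sums
  have hfloor : ∀ q, 1 ≤ q → ∀ V, ⌊(((q * N' q V : ℕ) : ℝ)) / q⌋₊ = N' q V := by
    intro q hq V
    have hq0 : (q : ℝ) ≠ 0 := by exact_mod_cast (by omega : q ≠ 0)
    rw [Nat.cast_mul, mul_div_cancel_left₀ _ hq0, Nat.floor_natCast]
  have hBVterm : ∀ q, 1 ≤ q → ∀ V,
      ∑ n ∈ Icc 1 ⌊(((q * N' q V : ℕ) : ℝ)) / q⌋₊, (liouville (Int.toNat ((q : ℤ) * n + c q)) : ℝ) =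
        ∑ n ∈ Icc 1 (N' q V), (liouville (q * n + cn q) : ℝ) := by
    intro q hq V
    rw [hfloor q hq V]
    refine Finset.sum_congr rfl fun n _ => ?_
    have : (q : ℤ) * n + c q = ((q * n + cn q : ℕ) : ℤ) := by push_cast; rw [hcn_eq q hq]
    rw [this, Int.toNat_natCast]
  -- the class condition
  have hclass : ∀ q : ℕ, 1 ≤ q → ∀ v : ℕ, ((v : ℤ) ≡ r q [ZMOD (q : ℤ)]) ↔ v % q = cn q := by
    intro q hq v
    have e : ((v : ℤ) ≡ r q [ZMOD (q : ℤ)]) ↔ ((v % q : ℕ) : ℤ) = ((cn q : ℕ) : ℤ) := by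
      rw [hcn_eq q hq, Int.natCast_mod]
      rfl
    rw [e]
    exact Int.natCast_inj
  -- termwise bound
  have hterm : ∀ q ∈ Icc 1 Q,
      |∑ v ∈ (Ioc (V₁ q) (V₂ q)).filter (fun v : ℕ => (v : ℤ) ≡ r q [ZMOD q]), (liouville v : ℝ)| ≤
        |∑ n ∈ Icc 1 ⌊y₂ q / q⌋₊, (liouville (Int.toNat ((q : ℤ) * n + c q)) : ℝ)| +
        |∑ n ∈ Icc 1 ⌊y₁ q / q⌋₊, (liouville (Int.toNat ((q : ℤ) * n + c q)) : ℝ)| + 2 := by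
    intro q hq
    have hq1 : 1 ≤ q := (Finset.mem_Icc.mp hq).1
    have hfilt : ∀ W : ℕ, (Ioc 0 W).filter (fun v : ℕ => (v : ℤ) ≡ r q [ZMOD q]) =
        (Ioc 0 W).filter (fun v : ℕ => v % q = cn q) := fun W =>
      Finset.filter_congr fun v _ => hclass q hq1 v
    have hfilt' : (Ioc (V₁ q) (V₂ q)).filter (fun v : ℕ => (v : ℤ) ≡ r q [ZMOD q]) =
        (Ioc (V₁ q) (V₂ q)).filter (fun v : ℕ => v % q = cn q) :=
      Finset.filter_congr fun v _ => hclass q hq1 v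
    rw [hfilt', sum_filter_Ioc_eq_sub _ _ (hV q), hy₂def, hy₁def]
    simp only []
    rw [hBVterm q hq1 (V₂ q), hBVterm q hq1 (V₁ q)]
    have hG₂ := abs_sum_filter_Ioc_modEq_le (hcn_lt q hq1) (V₂ q)
    have hG₁ := abs_sum_filter_Ioc_modEq_le (hcn_lt q hq1) (V₁ q)
    calc _ ≤ |∑ v ∈ (Ioc 0 (V₂ q)).filter (fun v : ℕ => v % q = cn q), (liouville v : ℝ)| +
          |∑ v ∈ (Ioc 0 (V₁ q)).filter (fun v : ℕ => v % q = cn q), (liouville v : ℝ)| :=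
          abs_sub _ _
      _ ≤ _ := by linarith
  -- `Q ≤ x^{1/2-ε} ≤ x/(log x)^A`
  have hQx : (Q : ℝ) ≤ x / L ^ A := by
    have hQ1 : (Q : ℝ) ≤ x ^ (1 / 2 - ε) := Nat.floor_le (by positivity)
    rw [le_div_iff₀ hLA]
    calc (Q : ℝ) * L ^ A ≤ x ^ (1 / 2 - ε) * x ^ (1 / 2 + ε) :=
          mul_le_mul hQ1 hlog hLA.le (by positivity)
      _ = x := by rw [← Real.rpow_add hx0]; norm_num
  calc ∑ q ∈ Icc 1 Q, |∑ v ∈ (Ioc (V₁ q) (V₂ q)).filter (fun v : ℕ => (v : ℤ) ≡ r q [ZMOD q]),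
          (liouville v : ℝ)|
      ≤ ∑ q ∈ Icc 1 Q, (|∑ n ∈ Icc 1 ⌊y₂ q / q⌋₊, (liouville (Int.toNat ((q : ℤ) * n + c q)) : ℝ)| +
          |∑ n ∈ Icc 1 ⌊y₁ q / q⌋₊, (liouville (Int.toNat ((q : ℤ) * n + c q)) : ℝ)| + 2) :=
        Finset.sum_le_sum hterm
    _ = ∑ q ∈ Icc 1 Q, |∑ n ∈ Icc 1 ⌊y₂ q / q⌋₊, (liouville (Int.toNat ((q : ℤ) * n + c q)) : ℝ)| +
          ∑ q ∈ Icc 1 Q, |∑ n ∈ Icc 1 ⌊y₁ q / q⌋₊, (liouville (Int.toNat ((q : ℤ) * n + c q)) : ℝ)| +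
          2 * Q := by
        rw [Finset.sum_add_distrib, Finset.sum_add_distrib, Finset.sum_const, Nat.card_Icc,
          Nat.add_sub_cancel, nsmul_eq_mul]
        ring
    _ ≤ C₀ * x / L ^ A + C₀ * x / L ^ A + 2 * (x / L ^ A) := by
        gcongr
    _ = (2 * C₀ + 2) * x / L ^ A := by ring

end Summit.Parity.GeneralizedHardyLittlewood.Theorems.AbsoluteUpgrade

end
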